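import Mathlib
import Literature.MathematicalPhysics.StatisticalMechanics.BarlowStacking
import Literature.MathematicalPhysics.StatisticalMechanics.BarlowCoordination

/-!
# Radius bootstrap of crux 14294, stub W1: the relaxed Barlow shell census

Crux `StackingFaultSparsity` (stmt-AtomisticToContinuum-14296), line `Sketch`, reshape 14 (lead c8): registered stub
`stub_shellCensus`.  In `barlowStacking a h s` (`s` Hägg, `19/20 ≤ a ≤ 1`, `19/25 ≤ h`, `a²/3 + h² ≤ 1`) every
stacking point within `6/5` of a stacking point `z` lies in the layer of `z` or an adjacent layer; the in-layer ones
other than `z` are at most six, all at distance `a`; each adjacent layer contributes at most three, all at distance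
`√(a²/3 + h²)`.  Tools: `dist_barlowPos_sq`, `barlowPos_apply_two`, `haggLabel_succ`, the integer forms of
`BarlowCoordination.lean`.  All `[folklore]`.
-/

noncomputable section

namespace Summit.AtomisticToContinuum.Crystallization.Theorems.SquareWellLayerCake.StackingFaultSparsity.Bootstrap.ShellCensus

open Literature.MathematicalPhysics.StatisticalMechanics

/-! ## Integer lemma: the adjacent-layer form jumps from `4` to `16` -/

/-- **Next value after `4` is `16`**: for a letter shift `σ = ±1`, if the adjacent-layer form
`3(2P+Q+σ)² + (3Q+σ)²` is `< 16` then it equals `4` (so `(P, Q)` is one of the three touching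
offsets). [folklore] -/
theorem adjLayer_eq_four_of_lt_sixteen {P Q σ : ℤ} (hσ : σ = 1 ∨ σ = -1)
    (hF : 3 * (2 * P + Q + σ) ^ 2 + (3 * Q + σ) ^ 2 < 16) :
    3 * (2 * P + Q + σ) ^ 2 + (3 * Q + σ) ^ 2 = 4 := by
  have hv : (3 * Q + σ) ^ 2 ≤ 15 := by nlinarith [sq_nonneg (2 * P + Q + σ)]
  have hu3 : 3 * (2 * P + Q + σ) ^ 2 ≤ 15 := by nlinarith [sq_nonneg (3 * Q + σ)]
  have hv1 : -3 ≤ 3 * Q + σ := by nlinarith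
  have hv2 : 3 * Q + σ ≤ 3 := by nlinarith
  have hu1 : -2 ≤ 2 * P + Q + σ := by nlinarith
  have hu2 : 2 * P + Q + σ ≤ 2 := by nlinarith
  rcases hσ with rfl | rfl
  · have hQ1 : -1 ≤ Q := by omega
    have hQ2 : Q ≤ 0 := by omega
    have hP1 : -2 ≤ P := by omega
    have hP2 : P ≤ 1 := by omega
    interval_cases P <;> interval_cases Q <;> omega
  · have hQ1 : 0 ≤ Q := by omega
    have hQ2 : Q ≤ 1 := by omega
    have hP1 : -2 ≤ P := by omega
    have hP2 : P ≤ 2 := by omega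
    interval_cases P <;> interval_cases Q <;> omega

/-! ## The distance form with free layer spacing `h` -/

/-- **`12 · dist² = a² · (3(2P+Q+Λ)² + (3Q+Λ)²) + 12 K² h²`** with `P = i − i'`, `Q = j − j'`,
`K = k − k'`, `Λ = L(k) − L(k')` (the relaxed version of `twelve_mul_dist_barlowPos_sq`, no
relation between `a` and `h`). [folklore] -/
theorem twelve_mul_dist_sq (a h : ℝ) (s : ℤ → ℤ) (k i j k' i' j' : ℤ) :
    12 * dist (barlowPos a h s k' i' j') (barlowPos a h s k i j) ^ 2 =
      a ^ 2 * ((3 * (2 * (i - i') + (j - j') + (haggLabel s k - haggLabel s k')) ^ 2 +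
        (3 * (j - j') + (haggLabel s k - haggLabel s k')) ^ 2 : ℤ) : ℝ) +
        12 * ((k : ℝ) - k') ^ 2 * h ^ 2 := by
  rw [dist_comm, dist_barlowPos_sq]
  have h3 : (√3 : ℝ) ^ 2 = 3 := Real.sq_sqrt (by norm_num)
  push_cast
  linear_combination
    (3 * a ^ 2 * ((j : ℝ) - j' + ((haggLabel s k : ℝ) - haggLabel s k') / 3) ^ 2) * h3

/-- **Layer selection**: two stacking points at distance `≤ 6/5 < 2h` lie in the same or in
adjacent layers (`dist ≥ |k' − k| h`). [folklore] -/
theorem layer_near {a h : ℝ} {s : ℤ → ℤ} (hh : 19 / 25 ≤ h) {k i j k' i' j' : ℤ}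
    (hd : dist (barlowPos a h s k' i' j') (barlowPos a h s k i j) ≤ 6 / 5) :
    k' = k ∨ k' = k + 1 ∨ k' = k - 1 := by
  have h1 := PiLp.dist_apply_le (barlowPos a h s k' i' j') (barlowPos a h s k i j) 2
  rw [barlowPos_apply_two, barlowPos_apply_two, Real.dist_eq, ← sub_mul, abs_mul,
    abs_of_nonneg (by linarith : (0 : ℝ) ≤ h)] at h1
  by_cases h2 : |k' - k| ≤ 1
  · rw [abs_le] at h2
    omega
  · exfalso
    have h2' : (2 : ℝ) ≤ |(k' : ℝ) - k| := by
      rw [← Int.cast_sub, ← Int.cast_abs]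
      exact_mod_cast (by omega : (2 : ℤ) ≤ |k' - k|)
    nlinarith [mul_le_mul_of_nonneg_right h2' (by linarith : (0 : ℝ) ≤ h)]

/-- **In-layer census core**: a point of the layer of `z = barlowPos a h s k i j`, other than `z`,
within `6/5` of `z`, is one of the six in-layer neighbours and is at distance exactly `a`
(`dist² = a² (P² + PQ + Q²)`, and `a ≥ 19/20` forces `P² + PQ + Q² = 1`). [folklore] -/
theorem inLayer_core {a h : ℝ} {s : ℤ → ℤ} (ha : 19 / 20 ≤ a) {k i j i' j' : ℤ}
    (hne : (i - i', j - j') ≠ 0)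
    (hd : dist (barlowPos a h s k i' j') (barlowPos a h s k i j) ≤ 6 / 5) :
    (i - i', j - j') ∈ sixOffsets ∧ dist (barlowPos a h s k i' j') (barlowPos a h s k i j) = a := by
  have hsq : dist (barlowPos a h s k i' j') (barlowPos a h s k i j) ^ 2 =
      a ^ 2 * ((i - i') ^ 2 + (i - i') * (j - j') + (j - j') ^ 2 : ℤ) := by
    rw [dist_comm, dist_barlowPos_sq]
    have h3 : (√3 : ℝ) ^ 2 = 3 := Real.sq_sqrt (by norm_num)
    push_cast
    linear_combination (a ^ 2 * ((j : ℝ) - j') ^ 2 / 4) * h3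
  set N : ℤ := (i - i') ^ 2 + (i - i') * (j - j') + (j - j') ^ 2 with hN
  have hN1 : 1 ≤ N := one_le_sq_add_mul_add_sq hne
  have ha2 : 361 / 400 ≤ a ^ 2 := by nlinarith
  have hd2 : dist (barlowPos a h s k i' j') (barlowPos a h s k i j) ^ 2 ≤ (6 / 5) ^ 2 :=
    pow_le_pow_left₀ dist_nonneg hd 2
  rw [hsq] at hd2
  have hN2 : N < 2 := by
    have hN' : (N : ℝ) < 2 := by
      by_contra hge
      rw [not_lt] at hge
      nlinarith [mul_nonneg (sq_nonneg a) (sub_nonneg.2 hge)]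
    exact_mod_cast hN'
  have hNeq : N = 1 := le_antisymm (by linarith) hN1
  refine ⟨mem_sixOffsets_iff.2 ?_, ?_⟩
  · have e : 3 * (2 * (i - i') + (j - j')) ^ 2 + (3 * (j - j')) ^ 2 = 12 * N := by
      rw [hN]; ring
    rw [e, hNeq]
    norm_num
  · rw [hNeq, Int.cast_one, mul_one] at hsq
    exact (sq_eq_sq₀ dist_nonneg (by linarith)).1 hsq

/-- **Adjacent-layer census core**: a point of a layer adjacent to that of
`z = barlowPos a h s k i j` (`(k − k')² = 1`, letter shift `σ = L(k) − L(k') = ±1`) within `6/5`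
of `z` has offset in `threeOffsets σ` and is at distance exactly `√(a²/3 + h²)`
(`12 dist² = a² F + 12 h²` with `F` the adjacent-layer form; `a ≥ 19/20`, `h ≥ 19/25` force
`F < 16`, hence `F = 4`). [folklore] -/
theorem adj_core {a h : ℝ} {s : ℤ → ℤ} (ha : 19 / 20 ≤ a) (hh : 19 / 25 ≤ h)
    {k i j k' i' j' σ : ℤ} (hσ : σ = 1 ∨ σ = -1) (hΛ : haggLabel s k - haggLabel s k' = σ)
    (hK : (k - k') ^ 2 = 1)
    (hd : dist (barlowPos a h s k' i' j') (barlowPos a h s k i j) ≤ 6 / 5) :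
    (i - i', j - j') ∈ threeOffsets σ ∧
      dist (barlowPos a h s k' i' j') (barlowPos a h s k i j) = √(a ^ 2 / 3 + h ^ 2) := by
  have h12 := twelve_mul_dist_sq a h s k i j k' i' j'
  have hK' : ((k : ℝ) - k') ^ 2 = 1 := by exact_mod_cast hK
  rw [hΛ, hK', mul_one] at h12
  set F : ℤ := 3 * (2 * (i - i') + (j - j') + σ) ^ 2 + (3 * (j - j') + σ) ^ 2 with hF
  have ha2 : 361 / 400 ≤ a ^ 2 := by nlinarith
  have hh2 : 361 / 625 ≤ h ^ 2 := by nlinarith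
  have hd2 : dist (barlowPos a h s k' i' j') (barlowPos a h s k i j) ^ 2 ≤ (6 / 5) ^ 2 :=
    pow_le_pow_left₀ dist_nonneg hd 2
  have hF16 : F < 16 := by
    have hF' : (F : ℝ) < 16 := by
      by_contra hge
      rw [not_lt] at hge
      nlinarith [mul_nonneg (sq_nonneg a) (sub_nonneg.2 hge)]
    exact_mod_cast hF'
  have hF4 : F = 4 := adjLayer_eq_four_of_lt_sixteen hσ hF16
  refine ⟨(mem_threeOffsets_iff hσ).2 hF4, ?_⟩
  rw [hF4] at h12
  push_cast at h12
  rw [← Real.sqrt_sq dist_nonneg]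
  congr 1
  linarith

/-- **Stub `stub_shellCensus` of line `Sketch` (reshape 14), by name and signature.** [folklore] -/
theorem stub_shellCensus :
    ∀ (a h : ℝ) (s : ℤ → ℤ), Literature.MathematicalPhysics.StatisticalMechanics.IsHaggSeq s → 19 / 20 ≤ a → a ≤ 1 → 19 / 25 ≤ h → a ^ 2 / 3 + h ^ 2 ≤ 1 → ∀ z ∈ Literature.MathematicalPhysics.StatisticalMechanics.barlowStacking a h s, (∀ q ∈ Literature.MathematicalPhysics.StatisticalMechanics.barlowStacking a h s, dist q z ≤ 6 / 5 → q 2 = z 2 ∨ q 2 = z 2 + h ∨ q 2 = z 2 - h) ∧ (∃ F : Finset (EuclideanSpace ℝ (Fin 3)), F.card ≤ 6 ∧ ∀ q ∈ Literature.MathematicalPhysics.StatisticalMechanics.barlowStacking a h s, q ≠ z → dist q z ≤ 6 / 5 → q 2 = z 2 → q ∈ F ∧ dist q z = a) ∧ (∃ F : Finset (EuclideanSpace ℝ (Fin 3)), F.card ≤ 3 ∧ ∀ q ∈ Literature.MathematicalPhysics.StatisticalMechanics.barlowStacking a h s, dist q z ≤ 6 / 5 → q 2 = z 2 + h → q ∈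 F ∧ dist q z = √(a ^ 2 / 3 + h ^ 2)) ∧ (∃ F : Finset (EuclideanSpace ℝ (Fin 3)), F.card ≤ 3 ∧ ∀ q ∈ Literature.MathematicalPhysics.StatisticalMechanics.barlowStacking a h s, dist q z ≤ 6 / 5 → q 2 = z 2 - h → q ∈ F ∧ dist q z = √(a ^ 2 / 3 + h ^ 2)) := by
  classical
  intro a h s hs ha _ hh _ z hz
  obtain ⟨k, i, j, rfl⟩ := hz
  have hh0 : (0 : ℝ) < h := by linarith
  refine ⟨?_, ?_, ?_, ?_⟩
  · -- only the same and the adjacent layers are seen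
    rintro q ⟨k', i', j', rfl⟩ hd
    rcases layer_near hh hd with rfl | rfl | rfl
    · left
      rw [barlowPos_apply_two, barlowPos_apply_two]
    · refine Or.inr (Or.inl ?_)
      simp only [barlowPos_apply_two]
      push_cast
      ring
    · refine Or.inr (Or.inr ?_)
      simp only [barlowPos_apply_two]
      push_cast
      ring
  · -- the same layer: at most six, all at distance `a`
    refine ⟨sixOffsets.image (offsetPos a h s i j k),
      Finset.card_image_le.trans card_sixOffsets.le, ?_⟩
    rintro q ⟨k', i', j', rfl⟩ hne hd h2
    simp only [barlowPos_apply_two] at h2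
    obtain rfl : k = k' := by exact_mod_cast (mul_right_cancel₀ hh0.ne' h2).symm
    have hne' : (i - i', j - j') ≠ 0 := by
      intro h0
      simp only [Prod.ext_iff, Prod.fst_zero, Prod.snd_zero, sub_eq_zero] at h0
      obtain ⟨rfl, rfl⟩ := h0
      exact hne rfl
    obtain ⟨hmem, hdist⟩ := inLayer_core ha hne' hd
    exact ⟨Finset.mem_image.2 ⟨_, hmem, by simp [offsetPos]⟩, hdist⟩
  · -- the layer above: at most three, all at distance `√(a²/3 + h²)`
    refine ⟨(threeOffsets (-s k)).image (offsetPos a h s i j (k + 1)),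
      Finset.card_image_le.trans (card_threeOffsets _).le, ?_⟩
    rintro q ⟨k', i', j', rfl⟩ hd h2
    simp only [barlowPos_apply_two] at h2
    obtain rfl : k' = k + 1 := by
      have e : ((k' : ℝ) - (k + 1)) * h = 0 := by linarith
      have e' := (mul_eq_zero.1 e).resolve_right hh0.ne'
      exact_mod_cast (by linarith : (k' : ℝ) = k + 1)
    have hσ : -s k = 1 ∨ -s k = -1 := by rcases hs k with h1 | h1 <;> omega
    obtain ⟨hmem, hdist⟩ :=
      adj_core ha hh hσ (haggLabel_sub_haggLabel_succ s k) (by ring) hd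
    exact ⟨Finset.mem_image.2 ⟨_, hmem, by simp [offsetPos]⟩, hdist⟩
  · -- the layer below: at most three, all at distance `√(a²/3 + h²)`
    refine ⟨(threeOffsets (s (k - 1))).image (offsetPos a h s i j (k - 1)),
      Finset.card_image_le.trans (card_threeOffsets _).le, ?_⟩
    rintro q ⟨k', i', j', rfl⟩ hd h2
    simp only [barlowPos_apply_two] at h2
    obtain rfl : k' = k - 1 := by
      have e : ((k' : ℝ) - (k - 1)) * h = 0 := by linarith
      have e' := (mul_eq_zero.1 e).resolve_right hh0.ne'
      exact_mod_cast (by linarith : (k' : ℝ) = k - 1)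
    obtain ⟨hmem, hdist⟩ :=
      adj_core ha hh (hs (k - 1)) (haggLabel_sub_haggLabel_pred s k) (by ring) hd
    exact ⟨Finset.mem_image.2 ⟨_, hmem, by simp [offsetPos]⟩, hdist⟩

end Summit.AtomisticToContinuum.Crystallization.Theorems.SquareWellLayerCake.StackingFaultSparsity.Bootstrap.ShellCensus

end
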